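import Summits.BirchSwinnertonDyer.BirchSwinnertonDyer.Theorems.ManinLocalTwoThreeShimuraIndexSquareBound
import Literature.NumberTheory.EllipticCurves.ManinConstantGamma1Gamma0LedgerProofs
import Literature.NumberTheory.EllipticCurves.EichlerShimuraConstruction
import Literature.NumberTheory.EllipticCurves.Uniformization
import HarnessLib

/-!
# THE OPTIMAL PAIR: `Λ₁(f) = Λ₀(f)` FORCES `E₁ = E₀` — trivial Shimura quotient ⟹ Stevens' `X₁(N)`-optimal curve and the
# `X₀(N)`-optimal curve have the same Néron lattice, the same `c₄, c₆, Δ, j`, and `|c₀| = |c₁|`; fact-free, and conversely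
# `Λ₁(f) = Λ₀(f) ⟺ (c₄(E₁) = c₄(E₀) ∧ c₆(E₁) = c₆(E₀) ∧ |c₀| = |c₁|)`

Summit `BirchSwinnertonDyer`, route `ManinLocalTwoThree` (cell bsd-f2-manin), crux C2 `ManinOddAtFour` (stmt-BirchSwinnertonDyer-22967;
the `9 ∣ N` corollary bears on C3, stmt-BirchSwinnertonDyer-22968).  Planner seat bsd-f2-manin-es (LENS es: the Shimura covering
`X₁(N) → X₀(N)` on period lattices), gen 46; TURNKEY T-es-115 for the C2/C3 LEAD.  In-tree imports only; independent of T-es-112…114.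

THE SETTING.  Two globally minimal elliptic `W₁, W₀ / ℚ` at one level `N`:
* `D₁ : Gamma1ParametrizationData W₁ N` OPTIMAL (`D₁.IsOptimal`: `Λ_{W₁} = c₁Λ₁(f)`, STEVENS' curve `E₁`);
* `D₀ : ModularParametrizationData W₀ N` LATTICE-OPTIMAL (`h₀ : Λ_{W₀} ⊆ c₀Λ₀(f)`, hence `= c₀Λ₀(f)`: the `X₀(N)`-OPTIMAL curve `E₀`);
* `IsIsogenous W₁ W₀` only where the two newforms must be identified (`Gamma1ParametrizationData.f_eq_of_isIsogenous`, a tree theorem).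

THE THEOREM (§2–§3, no fact binders).  If the Shimura quotient of the class is trivial, `Λ₁(f) = Λ₀(f)` (`f = D₀.f`), then
(a) `c₀ ∣ c₁` (`(c₁/c₀)Λ_{W₀} = c₁Λ₀ = c₁Λ₁ ⊆ Λ_{W₁}` and the integrality of Néron scalings between minimal models,
`integral_neronScaling_of_isGloballyMinimal_holds` — a PROVED tree theorem), so with ČNS 6.5 (`c₁ ∣ c₀`, tree theorem) **`|c₀| = |c₁|`**;
(b) **`Λ_{W₁} = Λ_{W₀}`** (`c₁Λ₁ = ±c₀Λ₀`); (c) **`c₄(W₁) = c₄(W₀)`, `c₆(W₁) = c₆(W₀)`** (`g₂, g₃` depend only on the lattice,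
`PeriodPair.g₂_eq_of_lattice_eq`; `IsNeronLatticeOf` reads `c₄/12, c₆/216` off them), hence `Δ(W₁) = Δ(W₀)` and `j(W₁) = j(W₀)`: the two
minimal models define the SAME curve (minimal models with equal `c₄, c₆` differ by an `[1; r, s, t]` change).  Contrapositively (§4):
**`E₁ ≠ E₀` (any of `c₄`, `c₆`, `Λ`, `|c|` differ) ⟹ `[Λ₀(f) : Λ₁(f)] ≠ 1`**, and then `∈ {2, 4}` at `4 ∣ N`, `∈ {3, 9}` at `9 ∣ N` (T-es-111 menus).
CONVERSELY (§3): if `c₄, c₆` agree then `Λ_{W₁} = Λ_{W₀}` (uniformisation uniqueness, tree theorem `IsNeronLatticeOf.lattice_eq`) and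
`Λ₁(f) = Λ₀(f) ⟺ |c₀| = |c₁|`; altogether **`Λ₁(f) = Λ₀(f) ⟺ (c₄(W₁) = c₄(W₀) ∧ c₆(W₁) = c₆(W₀) ∧ |c₀| = |c₁|)`**
(`periodLatticeGamma1_eq_iff_c₄_eq_and_c₆_eq_and_natAbs_eq`).  Under the two unit-constant facts of the tree (Cremona `|c₀| = 1`,
`N ≤ 5·10⁵`; Stevens `|c₁| = 1`) the last conjunct is automatic: «`[Λ₀(f) : Λ₁(f)] = 1 ⟺ E₀ = E₁`» class by class.

READING FOR THE CELL (es census E15, 1025 classes `N ≤ 500`; desc §65 law «index = max `X₀`-constant over the class»).  The index-1 classes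
(926) are EXACTLY the classes whose Stevens curve is the optimal curve, the 99 others (73 × 2, 23 × 3, 15a/17a × 4, 11a × 5) exactly those
with `E₁ ≠ E₀` — the direction `E₁ ≠ E₀ ⟹ index ≠ 1` by THIS file with no facts, the direction `index ≠ 1 ⟹ E₁ ≠ E₀` by T-es-114 §6 with
the unit constants.  PREDICTION handed to desc/ref1 (E-es-268): Cremona's curve 1 = Stevens' curve in precisely the 926 index-1 classes of E15.

HONEST FRAMING.  Lattice bookkeeping on Stevens 1989 §2 / ČNS 2024 Lemma 6.5 plus two proved tree theorems (integral Néron scalings between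
minimal models; uniformisation uniqueness); printed mathematics, new formal proof, in the `relIndex` currency of T-es-107…114.  No definitions,
no sorry, no fact binders.  C2, C3, Manin's conjecture and BSD are NOT proved by this file.
[cite: Stevens1989, §2 and Thm. 1.6] [cite: CesnaviciusNeururerSaha2023, Lemma 6.5 and §1 fn. 2] [cite: LingOesterle1991, Thm. 6]
[cite: SilvermanAEC2009, Thm. VI.5.1 and VII.1.3] [cite: SilvermanATAEC1994, Cor. IV.9.1] [cite: Cremona1997, §2.10 and Table] [cite: Manin1972, Thm. 1.6]
-/

set_option autoImplicit false
-- the summit-side namespace `Summit.BirchSwinnertonDyer.BirchSwinnertonDyer.…` is the tree's (summit = sub-problem)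
set_option linter.dupNamespace false

noncomputable section

open scoped Classical MatrixGroups

open CongruenceSubgroup Matrix.SpecialLinearGroup ModularGroup WeierstrassCurve
open Literature.NumberTheory.EllipticCurves Literature.NumberTheory.EllipticCurves.ModularForms

namespace Summit.BirchSwinnertonDyer.BirchSwinnertonDyer.Theorems.ManinLocalTwoThree.ShimuraIndex

section OptimalPair

variable {W₁ W₀ : WeierstrassCurve ℚ} [W₁.IsElliptic] [W₁.IsGloballyMinimal] [W₀.IsElliptic] [W₀.IsGloballyMinimal]
  {N : ℕ} [NeZero N]

/-! ## §1 The two optimal lattices -/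

omit [W₁.IsElliptic] [W₁.IsGloballyMinimal] [W₀.IsElliptic] [W₀.IsGloballyMinimal] in
/-- `Λ_{W₁} = c₁Λ₁(f)` for the optimal `X₁(N)`-datum (membership form). [cite: Stevens1989, §2] -/
theorem mem_lattice₁_iff_of_isOptimal (D₁ : Gamma1ParametrizationData W₁ N) (h₁ : D₁.IsOptimal) (z : ℂ) :
    z ∈ D₁.L.lattice ↔ ∃ w ∈ periodLatticeGamma1 D₁.f, z = D₁.c * w :=
  ⟨h₁ z, fun ⟨w, hw, e⟩ ↦ e ▸ D₁.smul_periodLatticeGamma1_le w hw⟩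

omit [W₁.IsElliptic] [W₁.IsGloballyMinimal] [W₀.IsElliptic] [W₀.IsGloballyMinimal] in
/-- `Λ_{W₀} = c₀Λ₀(f)` for a lattice-optimal `X₀(N)`-datum (membership form). [cite: Manin1972, Thm. 1.6] -/
theorem mem_lattice₀_iff_of_latticeOptimal (D₀ : ModularParametrizationData W₀ N)
    (h₀ : ∀ z ∈ D₀.L.lattice, ∃ w ∈ periodLattice D₀.f, z = D₀.c * w) (z : ℂ) :
    z ∈ D₀.L.lattice ↔ ∃ w ∈ periodLattice D₀.f, z = D₀.c * w :=
  ⟨h₀ z, fun ⟨w, hw, e⟩ ↦ e ▸ D₀.smul_periodLattice_le w hw⟩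

/-! ## §2 `Λ₁(f) = Λ₀(f)` ⟹ `|c₀| = |c₁|` and `Λ_{W₁} = Λ_{W₀}` -/

omit [W₁.IsElliptic] [W₁.IsGloballyMinimal] [W₀.IsElliptic] [W₀.IsGloballyMinimal] in
/-- Auxiliary: an integer cast equal to a ratio of integers forces divisibility. [folklore] -/
private theorem int_dvd_of_intCast_eq_ratDiv {a b k : ℤ} (hb : b ≠ 0) (h : (k : ℚ) = (a : ℚ) / (b : ℚ)) : b ∣ a := by
  refine ⟨k, ?_⟩
  have hbq : (b : ℚ) ≠ 0 := by exact_mod_cast hb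
  have e : (a : ℚ) = b * k := by rw [h]; field_simp
  exact_mod_cast e

/-- **`Λ₁(f) = Λ₀(f)` ⟹ `c₀ ∣ c₁`** (no optimality of `D₁` needed): `z ∈ Λ_{W₀}` is `c₀w` with `w ∈ Λ₀(f) = Λ₁(f)`, so
`(c₁/c₀)z = c₁w ∈ Λ_{W₁}`; the rational Néron scaling `c₁/c₀` between the two minimal models is an integer
(`integral_neronScaling_of_isGloballyMinimal_holds`). [cite: CesnaviciusNeururerSaha2023, Lemma 6.5] [cite: SilvermanATAEC1994, Cor. IV.9.1] -/
theorem maninConstant₀_dvd_maninConstant₁_of_periodLatticeGamma1_eq (D₁ : Gamma1ParametrizationData W₁ N)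
    (D₀ : ModularParametrizationData W₀ N) (hiso : IsIsogenous W₁ W₀)
    (h₀ : ∀ z ∈ D₀.L.lattice, ∃ w ∈ periodLattice D₀.f, z = D₀.c * w)
    (heq : periodLatticeGamma1 D₀.f = periodLattice D₀.f) : D₀.maninConstant ∣ D₁.maninConstant := by
  have hf : D₁.f = D₀.f := D₁.f_eq_of_isIsogenous D₀ hiso
  have hc₀ : (D₀.c : ℂ) ≠ 0 := by exact_mod_cast D₀.maninConstant_ne_zero_holds
  obtain ⟨k, hk⟩ := integral_neronScaling_of_isGloballyMinimal_holds W₀ W₁ D₀.L D₁.L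
    D₀.isNeronLattice D₁.isNeronLattice ((D₁.c : ℚ) / D₀.c) (fun z hz ↦ by
      obtain ⟨w, hw, rfl⟩ := h₀ z hz
      have hw₁ : w ∈ periodLatticeGamma1 D₁.f := by rw [hf, heq]; exact hw
      have e : ((((D₁.c : ℚ) / D₀.c : ℚ)) : ℂ) * ((D₀.c : ℂ) * w) = (D₁.c : ℂ) * w := by
        push_cast
        field_simp
      rw [e]
      exact D₁.smul_periodLatticeGamma1_le w hw₁)
  exact int_dvd_of_intCast_eq_ratDiv D₀.maninConstant_ne_zero_holds hk

/-- **`Λ₁(f) = Λ₀(f)` ⟹ `|c₀| = |c₁|`** for the optimal pair (`c₁ ∣ c₀`, ČNS 6.5 = tree theorem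
`IsOptimal.maninConstant_dvd_maninConstant`; `c₀ ∣ c₁` above). [cite: CesnaviciusNeururerSaha2023, Lemma 6.5] [cite: Stevens1989, §2] -/
theorem natAbs_maninConstant₀_eq_of_periodLatticeGamma1_eq (D₁ : Gamma1ParametrizationData W₁ N) (h₁ : D₁.IsOptimal)
    (D₀ : ModularParametrizationData W₀ N) (hiso : IsIsogenous W₁ W₀)
    (h₀ : ∀ z ∈ D₀.L.lattice, ∃ w ∈ periodLattice D₀.f, z = D₀.c * w)
    (heq : periodLatticeGamma1 D₀.f = periodLattice D₀.f) : D₀.maninConstant.natAbs = D₁.maninConstant.natAbs :=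
  Nat.dvd_antisymm
    (Int.natAbs_dvd_natAbs.mpr (maninConstant₀_dvd_maninConstant₁_of_periodLatticeGamma1_eq D₁ D₀ hiso h₀ heq))
    (Int.natAbs_dvd_natAbs.mpr (h₁.maninConstant_dvd_maninConstant D₀ hiso))

/-- **`Λ₁(f) = Λ₀(f)` ⟹ `Λ_{W₁} = Λ_{W₀}`**: `Λ_{W₁} = c₁Λ₁(f) = c₁Λ₀(f) = ±c₀Λ₀(f) = Λ_{W₀}`.
[cite: Stevens1989, §2] [cite: Manin1972, Thm. 1.6] -/
theorem lattice_eq_of_periodLatticeGamma1_eq (D₁ : Gamma1ParametrizationData W₁ N) (h₁ : D₁.IsOptimal)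
    (D₀ : ModularParametrizationData W₀ N) (hiso : IsIsogenous W₁ W₀)
    (h₀ : ∀ z ∈ D₀.L.lattice, ∃ w ∈ periodLattice D₀.f, z = D₀.c * w)
    (heq : periodLatticeGamma1 D₀.f = periodLattice D₀.f) : D₁.L.lattice = D₀.L.lattice := by
  have hf : D₁.f = D₀.f := D₁.f_eq_of_isIsogenous D₀ hiso
  have habs := natAbs_maninConstant₀_eq_of_periodLatticeGamma1_eq D₁ h₁ D₀ hiso h₀ heq
  have hcc : (D₀.c : ℂ) = D₁.c ∨ (D₀.c : ℂ) = -D₁.c := by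
    rcases Int.natAbs_eq_natAbs_iff.mp habs with h | h
    · left; exact_mod_cast h
    · right; exact_mod_cast h
  ext z
  constructor
  · intro hz
    obtain ⟨w, hw, rfl⟩ := h₁ z hz
    have hw₀ : w ∈ periodLattice D₀.f := hf ▸ periodLatticeGamma1_le_periodLattice D₁.f hw
    have hm : (D₀.c : ℂ) * w ∈ D₀.L.lattice := D₀.smul_periodLattice_le w hw₀
    rcases hcc with h | h
    · rw [← h]; exact hm
    · have : (D₁.c : ℂ) * w = -((D₀.c : ℂ) * w) := by rw [h]; ring
      rw [this]; exact neg_mem hm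
  · intro hz
    obtain ⟨w, hw, rfl⟩ := h₀ z hz
    have hw₁ : w ∈ periodLatticeGamma1 D₁.f := by rw [hf, heq]; exact hw
    have hm : (D₁.c : ℂ) * w ∈ D₁.L.lattice := D₁.smul_periodLatticeGamma1_le w hw₁
    rcases hcc with h | h
    · rw [h]; exact hm
    · have : (D₀.c : ℂ) * w = -((D₁.c : ℂ) * w) := by rw [h]; ring
      rw [this]; exact neg_mem hm

/-! ## §3 Same lattice ⟺ same `c₄, c₆`; the equivalence -/

omit [W₁.IsElliptic] [W₁.IsGloballyMinimal] [W₀.IsElliptic] [W₀.IsGloballyMinimal] [NeZero N] in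
/-- **Equal Néron lattices ⟹ equal `c₄` and `c₆`** (`g₂ = c₄/12`, `g₃ = c₆/216` are lattice invariants). [cite: SilvermanAEC2009, Thm. VI.5.1] -/
theorem c₄_eq_and_c₆_eq_of_lattice_eq {L₁ L₀ : PeriodPair} (hL₁ : IsNeronLatticeOf (W₁.baseChange ℂ) L₁)
    (hL₀ : IsNeronLatticeOf (W₀.baseChange ℂ) L₀) (h : L₁.lattice = L₀.lattice) : W₁.c₄ = W₀.c₄ ∧ W₁.c₆ = W₀.c₆ := by
  have h₂ := PeriodPair.g₂_eq_of_lattice_eq h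
  have h₃ := PeriodPair.g₃_eq_of_lattice_eq h
  rw [hL₁.1, hL₀.1] at h₂
  rw [hL₁.2, hL₀.2] at h₃
  simp only [WeierstrassCurve.baseChange, WeierstrassCurve.map_c₄, WeierstrassCurve.map_c₆, eq_ratCast] at h₂ h₃
  constructor
  · have e : (W₁.c₄ : ℂ) = W₀.c₄ := by
      have := congrArg (· * (12 : ℂ)) h₂
      simpa using this
    exact_mod_cast e
  · have e : (W₁.c₆ : ℂ) = W₀.c₆ := by
      have := congrArg (· * (216 : ℂ)) h₃
      simpa using this
    exact_mod_cast e

omit [W₁.IsElliptic] [W₁.IsGloballyMinimal] [W₀.IsElliptic] [W₀.IsGloballyMinimal] [NeZero N] in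
/-- **Equal `c₄, c₆` ⟹ equal Néron lattices** (uniformisation uniqueness, tree theorem `IsNeronLatticeOf.lattice_eq`).
[cite: SilvermanAEC2009, Thm. VI.5.1 (uniqueness)] -/
theorem lattice_eq_of_c₄_eq_of_c₆_eq {L₁ L₀ : PeriodPair} (hL₁ : IsNeronLatticeOf (W₁.baseChange ℂ) L₁)
    (hL₀ : IsNeronLatticeOf (W₀.baseChange ℂ) L₀) (h₄ : W₁.c₄ = W₀.c₄) (h₆ : W₁.c₆ = W₀.c₆) :
    L₁.lattice = L₀.lattice := by
  have hL₁' : IsNeronLatticeOf (W₀.baseChange ℂ) L₁ := by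
    refine ⟨?_, ?_⟩
    · rw [hL₁.1]; simp [WeierstrassCurve.baseChange, WeierstrassCurve.map_c₄, h₄]
    · rw [hL₁.2]; simp [WeierstrassCurve.baseChange, WeierstrassCurve.map_c₆, h₆]
  exact hL₁'.lattice_eq hL₀

omit [W₁.IsElliptic] [W₁.IsGloballyMinimal] [W₀.IsElliptic] [W₀.IsGloballyMinimal] [NeZero N] in
/-- Equal `c₄, c₆` ⟹ equal discriminants (`1728Δ = c₄³ − c₆²`, characteristic `0`). [cite: SilvermanAEC2009, III.1] -/
theorem Δ_eq_of_c₄_eq_of_c₆_eq (h₄ : W₁.c₄ = W₀.c₄) (h₆ : W₁.c₆ = W₀.c₆) : W₁.Δ = W₀.Δ := by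
  have e₁ := W₁.c_relation
  have e₀ := W₀.c_relation
  rw [h₄, h₆, ← e₀] at e₁
  exact mul_left_cancel₀ (by norm_num : (1728 : ℚ) ≠ 0) e₁

omit [W₁.IsGloballyMinimal] [W₀.IsGloballyMinimal] [NeZero N] in
/-- Equal `c₄, c₆` ⟹ equal `j`-invariants. [cite: SilvermanAEC2009, III.1] -/
theorem j_eq_of_c₄_eq_of_c₆_eq (h₄ : W₁.c₄ = W₀.c₄) (h₆ : W₁.c₆ = W₀.c₆) : W₁.j = W₀.j := by
  have hΔ' : W₁.Δ' = W₀.Δ' :=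
    Units.ext (by rw [WeierstrassCurve.coe_Δ', WeierstrassCurve.coe_Δ', Δ_eq_of_c₄_eq_of_c₆_eq h₄ h₆])
  rw [WeierstrassCurve.j, WeierstrassCurve.j, hΔ', h₄]

/-- **`Λ₁(f) = Λ₀(f)` ⟹ `c₄(W₁) = c₄(W₀) ∧ c₆(W₁) = c₆(W₀)`**: trivial Shimura quotient forces Stevens' curve and the `X₀(N)`-optimal
curve to have the same minimal invariants — `E₁ = E₀`. [cite: Stevens1989, §2] [cite: CesnaviciusNeururerSaha2023, Lemma 6.5] [cite: SilvermanAEC2009, Thm. VI.5.1] -/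
theorem c₄_eq_and_c₆_eq_of_periodLatticeGamma1_eq (D₁ : Gamma1ParametrizationData W₁ N) (h₁ : D₁.IsOptimal)
    (D₀ : ModularParametrizationData W₀ N) (hiso : IsIsogenous W₁ W₀)
    (h₀ : ∀ z ∈ D₀.L.lattice, ∃ w ∈ periodLattice D₀.f, z = D₀.c * w)
    (heq : periodLatticeGamma1 D₀.f = periodLattice D₀.f) : W₁.c₄ = W₀.c₄ ∧ W₁.c₆ = W₀.c₆ :=
  c₄_eq_and_c₆_eq_of_lattice_eq D₁.isNeronLattice D₀.isNeronLattice
    (lattice_eq_of_periodLatticeGamma1_eq D₁ h₁ D₀ hiso h₀ heq)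

/-- `Λ₁(f) = Λ₀(f)` ⟹ `j(W₁) = j(W₀)` and `Δ(W₁) = Δ(W₀)`. [cite: Stevens1989, §2] [cite: SilvermanAEC2009, Thm. VI.5.1] -/
theorem j_eq_and_Δ_eq_of_periodLatticeGamma1_eq (D₁ : Gamma1ParametrizationData W₁ N) (h₁ : D₁.IsOptimal)
    (D₀ : ModularParametrizationData W₀ N) (hiso : IsIsogenous W₁ W₀)
    (h₀ : ∀ z ∈ D₀.L.lattice, ∃ w ∈ periodLattice D₀.f, z = D₀.c * w)
    (heq : periodLatticeGamma1 D₀.f = periodLattice D₀.f) : W₁.j = W₀.j ∧ W₁.Δ = W₀.Δ := by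
  obtain ⟨h₄, h₆⟩ := c₄_eq_and_c₆_eq_of_periodLatticeGamma1_eq D₁ h₁ D₀ hiso h₀ heq
  exact ⟨j_eq_of_c₄_eq_of_c₆_eq h₄ h₆, Δ_eq_of_c₄_eq_of_c₆_eq h₄ h₆⟩

/-- **Same Néron lattice ⟹ (`Λ₁(f) = Λ₀(f) ⟺ |c₀| = |c₁|`)**: on `E₁ = E₀` one has `c₁Λ₁(f) = Λ_W = c₀Λ₀(f)`, so the Shimura quotient is
trivial exactly when the two optimal constants agree up to sign. [cite: Stevens1989, §2] [cite: Manin1972, Thm. 1.6] [cite: LingOesterle1991, Thm. 6] -/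
theorem periodLatticeGamma1_eq_iff_natAbs_eq_of_lattice_eq (D₁ : Gamma1ParametrizationData W₁ N) (h₁ : D₁.IsOptimal)
    (D₀ : ModularParametrizationData W₀ N) (hiso : IsIsogenous W₁ W₀)
    (h₀ : ∀ z ∈ D₀.L.lattice, ∃ w ∈ periodLattice D₀.f, z = D₀.c * w) (hL : D₁.L.lattice = D₀.L.lattice) :
    periodLatticeGamma1 D₀.f = periodLattice D₀.f ↔ D₀.maninConstant.natAbs = D₁.maninConstant.natAbs := by
  refine ⟨natAbs_maninConstant₀_eq_of_periodLatticeGamma1_eq D₁ h₁ D₀ hiso h₀, fun habs ↦ ?_⟩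
  have hf : D₁.f = D₀.f := D₁.f_eq_of_isIsogenous D₀ hiso
  have hc₁ : (D₁.c : ℂ) ≠ 0 := by exact_mod_cast D₁.maninConstant_ne_zero
  refine le_antisymm (periodLatticeGamma1_le_periodLattice _) fun z hz ↦ ?_
  have hm : (D₀.c : ℂ) * z ∈ D₁.L.lattice := hL ▸ D₀.smul_periodLattice_le z hz
  obtain ⟨w, hw, e⟩ := h₁ _ hm
  rw [← hf]
  rcases Int.natAbs_eq_natAbs_iff.mp habs with h | h
  · have hc : (D₀.c : ℂ) = D₁.c := by exact_mod_cast h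
    rw [hc] at e
    rw [mul_left_cancel₀ hc₁ e]; exact hw
  · have hc : (D₀.c : ℂ) = -D₁.c := by exact_mod_cast h
    rw [hc, neg_mul, neg_eq_iff_eq_neg, ← mul_neg] at e
    rw [mul_left_cancel₀ hc₁ e]
    exact neg_mem hw

/-- **THE EQUIVALENCE `Λ₁(f) = Λ₀(f) ⟺ (c₄(W₁) = c₄(W₀) ∧ c₆(W₁) = c₆(W₀) ∧ |c₀| = |c₁|)`** for the optimal pair of a class
(globally minimal models; no fact binders).  Under Cremona's `|c₀| = 1` and Stevens' `|c₁| = 1` the last conjunct is automatic: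
«the Shimura quotient of the class is trivial iff its Stevens curve is its optimal curve».
[cite: Stevens1989, §2] [cite: CesnaviciusNeururerSaha2023, Lemma 6.5] [cite: SilvermanAEC2009, Thm. VI.5.1] [cite: Cremona1997, §2.10] -/
theorem periodLatticeGamma1_eq_iff_c₄_eq_and_c₆_eq_and_natAbs_eq (D₁ : Gamma1ParametrizationData W₁ N) (h₁ : D₁.IsOptimal)
    (D₀ : ModularParametrizationData W₀ N) (hiso : IsIsogenous W₁ W₀)
    (h₀ : ∀ z ∈ D₀.L.lattice, ∃ w ∈ periodLattice D₀.f, z = D₀.c * w) :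
    periodLatticeGamma1 D₀.f = periodLattice D₀.f ↔
      W₁.c₄ = W₀.c₄ ∧ W₁.c₆ = W₀.c₆ ∧ D₀.maninConstant.natAbs = D₁.maninConstant.natAbs := by
  constructor
  · intro heq
    obtain ⟨h₄, h₆⟩ := c₄_eq_and_c₆_eq_of_periodLatticeGamma1_eq D₁ h₁ D₀ hiso h₀ heq
    exact ⟨h₄, h₆, natAbs_maninConstant₀_eq_of_periodLatticeGamma1_eq D₁ h₁ D₀ hiso h₀ heq⟩
  · rintro ⟨h₄, h₆, habs⟩
    exact (periodLatticeGamma1_eq_iff_natAbs_eq_of_lattice_eq D₁ h₁ D₀ hiso h₀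
      (lattice_eq_of_c₄_eq_of_c₆_eq D₁.isNeronLattice D₀.isNeronLattice h₄ h₆)).mpr habs

/-! ## §4 Contrapositives: `E₁ ≠ E₀` ⟹ `[Λ₀(f) : Λ₁(f)] ≠ 1`; at `4 ∣ N` `∈ {2, 4}`, at `9 ∣ N` `∈ {3, 9}` -/

/-- **`c₄(W₁) ≠ c₄(W₀)` or `c₆(W₁) ≠ c₆(W₀)` ⟹ `Λ₁(f) ≠ Λ₀(f)`.** [cite: Stevens1989, §2] [cite: LingOesterle1991, Thm. 6] -/
theorem periodLatticeGamma1_ne_of_c₄_ne_or_c₆_ne (D₁ : Gamma1ParametrizationData W₁ N) (h₁ : D₁.IsOptimal)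
    (D₀ : ModularParametrizationData W₀ N) (hiso : IsIsogenous W₁ W₀)
    (h₀ : ∀ z ∈ D₀.L.lattice, ∃ w ∈ periodLattice D₀.f, z = D₀.c * w) (hne : W₁.c₄ ≠ W₀.c₄ ∨ W₁.c₆ ≠ W₀.c₆) :
    periodLatticeGamma1 D₀.f ≠ periodLattice D₀.f := fun heq ↦ by
  obtain ⟨h₄, h₆⟩ := c₄_eq_and_c₆_eq_of_periodLatticeGamma1_eq D₁ h₁ D₀ hiso h₀ heq
  exact hne.elim (fun h ↦ h h₄) (fun h ↦ h h₆)

/-- **`|c₀| ≠ |c₁|` ⟹ `Λ₁(f) ≠ Λ₀(f)`.** [cite: CesnaviciusNeururerSaha2023, Lemma 6.5] [cite: LingOesterle1991, Thm. 6] -/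
theorem periodLatticeGamma1_ne_of_natAbs_ne (D₁ : Gamma1ParametrizationData W₁ N) (h₁ : D₁.IsOptimal)
    (D₀ : ModularParametrizationData W₀ N) (hiso : IsIsogenous W₁ W₀)
    (h₀ : ∀ z ∈ D₀.L.lattice, ∃ w ∈ periodLattice D₀.f, z = D₀.c * w)
    (hne : D₀.maninConstant.natAbs ≠ D₁.maninConstant.natAbs) : periodLatticeGamma1 D₀.f ≠ periodLattice D₀.f := fun heq ↦
  hne (natAbs_maninConstant₀_eq_of_periodLatticeGamma1_eq D₁ h₁ D₀ hiso h₀ heq)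

/-- **`E₁ ≠ E₀` ⟹ `[Λ₀(f) : Λ₁(f)] ≠ 1`.** [cite: Stevens1989, §2] [cite: LingOesterle1991, Thm. 6] -/
theorem relIndex_ne_one_of_c₄_ne_or_c₆_ne (D₁ : Gamma1ParametrizationData W₁ N) (h₁ : D₁.IsOptimal)
    (D₀ : ModularParametrizationData W₀ N) (hiso : IsIsogenous W₁ W₀)
    (h₀ : ∀ z ∈ D₀.L.lattice, ∃ w ∈ periodLattice D₀.f, z = D₀.c * w) (hne : W₁.c₄ ≠ W₀.c₄ ∨ W₁.c₆ ≠ W₀.c₆) :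
    (periodLatticeGamma1 D₀.f).relIndex (periodLattice D₀.f) ≠ 1 := fun h ↦
  periodLatticeGamma1_ne_of_c₄_ne_or_c₆_ne D₁ h₁ D₀ hiso h₀ hne
    (le_antisymm (periodLatticeGamma1_le_periodLattice _) (AddSubgroup.relIndex_eq_one.mp h))

/-- **At `4 ∣ N`: `E₁ ≠ E₀` ⟹ `[Λ₀(f) : Λ₁(f)] ∈ {2, 4}`** (T-es-111 `relIndex_eq_one_or_two_or_four_of_four_dvd`).  The C2 reading: in a
class with `4 ∣ N` whose Stevens curve is not the optimal curve, the Shimura quotient is a non-trivial `2`-group.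
[cite: LingOesterle1991, Thm. 6] [cite: Stevens1989, §2] -/
theorem relIndex_eq_two_or_four_of_four_dvd_of_c₄_ne_or_c₆_ne (D₁ : Gamma1ParametrizationData W₁ N) (h₁ : D₁.IsOptimal)
    (D₀ : ModularParametrizationData W₀ N) (hiso : IsIsogenous W₁ W₀)
    (h₀ : ∀ z ∈ D₀.L.lattice, ∃ w ∈ periodLattice D₀.f, z = D₀.c * w) (h4 : 2 ^ 2 ∣ N)
    (hne : W₁.c₄ ≠ W₀.c₄ ∨ W₁.c₆ ≠ W₀.c₆) :
    (periodLatticeGamma1 D₀.f).relIndex (periodLattice D₀.f) = 2 ∨ (periodLatticeGamma1 D₀.f).relIndex (periodLattice D₀.f) = 4 := by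
  rcases relIndex_eq_one_or_two_or_four_of_four_dvd D₀ h4 with h | h | h
  · exact absurd h (relIndex_ne_one_of_c₄_ne_or_c₆_ne D₁ h₁ D₀ hiso h₀ hne)
  · exact Or.inl h
  · exact Or.inr h

/-- **At `9 ∣ N`: `E₁ ≠ E₀` ⟹ `[Λ₀(f) : Λ₁(f)] ∈ {3, 9}`.** [cite: LingOesterle1991, Thm. 6] [cite: Stevens1989, §2] -/
theorem relIndex_eq_three_or_nine_of_nine_dvd_of_c₄_ne_or_c₆_ne (D₁ : Gamma1ParametrizationData W₁ N) (h₁ : D₁.IsOptimal)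
    (D₀ : ModularParametrizationData W₀ N) (hiso : IsIsogenous W₁ W₀)
    (h₀ : ∀ z ∈ D₀.L.lattice, ∃ w ∈ periodLattice D₀.f, z = D₀.c * w) (h9 : 3 ^ 2 ∣ N)
    (hne : W₁.c₄ ≠ W₀.c₄ ∨ W₁.c₆ ≠ W₀.c₆) :
    (periodLatticeGamma1 D₀.f).relIndex (periodLattice D₀.f) = 3 ∨ (periodLatticeGamma1 D₀.f).relIndex (periodLattice D₀.f) = 9 := by
  rcases relIndex_eq_one_or_three_or_nine_of_nine_dvd D₀ h9 with h | h | h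
  · exact absurd h (relIndex_ne_one_of_c₄_ne_or_c₆_ne D₁ h₁ D₀ hiso h₀ hne)
  · exact Or.inl h
  · exact Or.inr h

end OptimalPair

end Summit.BirchSwinnertonDyer.BirchSwinnertonDyer.Theorems.ManinLocalTwoThree.ShimuraIndex
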